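import Summits.ResolutionOfSingularities.ResolutionOfSingularities.Theses.IndSmooth
import Literature.RingTheory.Localization.DerivationFractionField

/-!
# Disproof of `ValuativeSmoothing` (crux stmt-ResolutionOfSingularities-16087) — findings

Standing disprover's work file (cdisprove gen 1, cycle 1, 2026-08-17; route
`route-ResolutionOfSingularities-IndSmooth`, crux rank 2; line `birth` picked by the lead,
skeleton 757f03f6 with stubs `stub_existsMinimal`, `stub_refineOfNotZeroDim`, `stub_ciLimits`,
`stub_ciToSmooth`). Everything below is kernel-checked and sorry-free.

The crux `C = IndSmooth.ValuativeSmoothing`: for every prime `p`, every PERFECT field `k` of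
characteristic `p`, every finitely generated field extension `K/k`, every valuation ring `O` of `K`
containing `k` and every finitely generated `k`-subalgebra `R ⊆ O`, the inclusion `R ↪ O` factors
`R →ψ T →χ O` through a SMOOTH `k`-algebra `T` (`χ ∘ ψ = incl`, `χ` not required injective) —
"valuation rings of function fields over perfect fields are ind-smooth" (Stacks 07C3 criterion
restricted to f.g. subalgebras, which is equivalent).

## VERDICT (cycle 1): NO KILL — and none is available short of deciding the summit.
`C` is implied by relative local uniformization over perfect fields (route support item
`UniformizingToSmooth`, stmt-16090: shrink a model regular at the centre to a regular = smooth basic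
open inside `O`, `k` perfect), hence by the summit through the tree's
`ResolutionInChar.relLocalUniformization`; so `¬ C` refutes local uniformization in characteristic
`p` and decides `ResolutionOfSingularities` NEGATIVELY. Every instance with `trdeg K/k ≤ 3`
(CossartPiltant2008/2009 LU, `k` perfect) or with an Abhyankar valuation (KnafKuhlmann2005) is
TRUE, the bottom `K = k` is true with `T = k` (`smoothingAt_self`), `O = K` is true by generic
smoothness; so a counterexample must be a DEFECT valuation in transcendence degree `≥ 4` — the
frontier of LU itself. No instance is finite, decidable or computable (each quantifies over all
smooth algebras), so no `decide` / `kit compute` attack applies. Printed status: the absolute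
question is OPEN (AntieauDatta2021 §4 proves it only for PERFECT `O`, Prop. 27, from Temkin's
inseparable LU — re-read p. 12 this session; ElmantoEtAl2020 Thm 84, Tang2024 p. 1 likewise);
Popescu's [Po1] negative result concerns the RELATIVE statement over an immediate
sub-valuation-ring `V₀ ⊂ V`, not `C`. (Literature search degraded this session: local index daemon
down, arXiv/galaxy phrase searches 0 hits for a counterexample.)

## INDEX OF FINDINGS
* §0 `SmoothingAt k K` = the body of the crux for one pair `k ⊆ K`; `valuativeSmoothing_iff`
  (`Iff.rfl`): the crux is `∀ p prime, ∀ k (char p, perfect) K, SmoothingAt k K`.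
* §1 SANITY. `algebraMap_mem_of_le`: hypothesis `hO : k ⊆ O` is REDUNDANT (implied by `R ≤ O`,
  since `k ⊆ R`; also landed by the vetting seat as `…Negative.algebraMap_mem_of_subalgebra_le`,
  p146418); `le_of_smoothFactor`: the conclusion forces `R ≤ O` (so `hRO` cannot be weakened);
  `smoothingAt_self`: the degenerate instance `K = k` holds (`T = k`); `hypotheses_satisfiable`:
  the hypothesis set is consistent (not vacuous).
* §2 LOAD-BEARING: `PerfectField k` — TWO independent proofs now exist.
  (a) LANDED by the vetting seat (p146418, `Theorems/ValuativeSmoothing/Negative/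
  FalseWithoutPerfectField.lean`, `valuativeSmoothing_false_without_perfectField`): `p = 2`,
  `k = 𝔽₂(t)`, `K = k(√t)`, `O = R = K`; retract of smooth ⇒ formally smooth ⇒ separable
  (Matsumura 26.9, tree `Algebra.IsSeparable.of_formallySmooth_of_isAlgebraic`).
  (b) HERE (§2, proposed as `…/Negative/LoadBearing.lean`): failure at EVERY prime
  (`not_smoothingAt_insep p`, `valuativeSmoothingWithoutPerfectField_fails_at`): `k = 𝔽_p(x)`,
  `K = k(x^{1/p})`, `O = K`, `R = K`; retraction-free mechanism
  `false_of_pow_char_eq_algebraMap`: NO formally smooth `k`-algebra `T ≠ 0` contains a `p`-th root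
  of an `a ∈ k` with `D a ≠ 0` for some derivation `D` of `k` (lift `id_T` through the square-zero
  extension `T[ε] ↠ T` with `k`-structure twisted by `D`: `σ(a) = a + D(a)ε` but
  `σ(b^p) = σ(b)^p` has `ε`-part `p·(…) = 0`). It uses neither `χ ∘ ψ = incl` nor algebraicity:
  over imperfect `k`, NO valuation ring `O ∋ a^{1/p}` of ANY `K` admits even one map
  `k[a^{1/p}] → T ≠ 0` smooth. LESSON FOR PROVERS: perfectness of `k` must enter exactly to
  exclude inseparability over `k` inside `O`; over imperfect `k` the right target is "regular",
  not "smooth over `k`" (barrier `RegularNotGeometricallyRegular`).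
* §3 LOAD-BEARING: `R.FG` (left "on paper" by the vetting seat; PROVED here, proposed in
  `LoadBearing.lean`). `valuativeSmoothing_false_without_fg : ¬ ValuativeSmoothingWithoutFG`
  (`k = 𝔽_2`, `K = O = R = 𝔽_2(x)`: a retract of a smooth algebra is of finite type, and a field
  of finite type over `k` is algebraic — Zariski's lemma, Mathlib's
  `MvPolynomial.comp_C_integral_of_surjective_of_isJacobsonRing` — while `x` is transcendental).
  So the factorisation is genuinely "ind": `O` itself is never a retract of one smooth algebra
  unless `K/k` is algebraic; any smoothing step must produce `T` depending on `R`.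
* §4 NOT ATTACKABLE HERE (prose): dropping `(⊤ : IntermediateField k K).FG` — open even so (true
  for perfect `K`, AntieauDatta2021 Prop 27; no printed counterexample); dropping `CharP k p` /
  `p.Prime` — characteristic `0` is TRUE (Zariski LU), composite `p` vacuous; strengthening `χ`
  injective — that is `LurelPerfect` (crux 3's business, open); the relative version over a
  sub-valuation-ring — FALSE in print ([Po1], algebraic pseudo-convergent sequences) but needs
  Kaplansky theory not in tree.

## Targets (the lead's skeleton 757f03f6; no stuck stubs handed to this seat yet) — ALL SURVIVE
* `stub_existsMinimal` (a MINIMAL valuation subring `O'` with `R ≤ O' ≤ O`): TRUE — the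
  intersection of a chain of valuation subrings containing `R` is a valuation subring containing
  `R` (if `x ∉ ⋂` then `x ∉ O₁` for some member, so `x⁻¹ ∈ O₂` for every member: those `⊇ O₁`
  contain `x⁻¹ ∈ O₁`, those `⊆ O₁` miss `x`), and Zorn downward. No hypothesis to mutate (none
  besides `R ≤ O`, which only fixes the candidate set).
* `stub_refineOfNotZeroDim` (`κ(O)` not algebraic over `k`, `R` f.g. `⇒ ∃ O'`, `R ≤ O' < O`):
  TRUE — the image `R̄ ⊆ κ(O)` is a f.g. `k`-algebra; if `R̄` is not a field dominate `R̄_𝔪` by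
  a valuation ring of `κ(O)` (Chevalley), else `R̄` is finite over `k` (Zariski) and `R̄[t]`,
  `t ∈ κ(O)` transcendental, is dominated at `(t)`; pull back to `O`. `hR : R.FG` IS load-bearing
  there (with `R = O.toSubalgebra` the conclusion is false) — but that mutation is outside the
  crux's cone only formally: it is §3's phenomenon again.
* `stub_ciLimits`, `stub_ciToSmooth`: both are CONSEQUENCES of the crux (skeleton:
  `ciLimits_of_valuativeSmoothing`, `ciToSmooth_of_valuativeSmoothing`), hence of LU; irrefutable
  here for the same reason as `C`. §2 says their proofs must use `[PerfectField k]`; §3 says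
  `stub_ciToSmooth` must let `T` depend on `φ`. Degenerate check: `C = 0` is a "c.i. algebra"
  (`f = [1]` is weakly regular) but admits no `φ : 0 →ₐ[k] K`, so no vacuity leak.
-/
noncomputable section

set_option linter.dupNamespace false

namespace Summit.ResolutionOfSingularities.ResolutionOfSingularities.Cruxes.ValuativeSmoothing.Disproof

open Summit.ResolutionOfSingularities.ResolutionOfSingularities.Theses.IndSmooth
open Polynomial

/-! ## §0 The crux, one pair of fields at a time -/

/-- The body of `ValuativeSmoothing` for one extension `k ⊆ K` (no hypothesis on `k`): every
finitely generated `k`-subalgebra `R` of a valuation ring `O ⊇ k` of `K` factors into `O` through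
a smooth `k`-algebra. -/
def SmoothingAt (k K : Type) [Field k] [Field K] [Algebra k K] : Prop :=
  (⊤ : IntermediateField k K).FG → ∀ O : ValuationSubring K, (∀ c : k, algebraMap k K c ∈ O) →
    ∀ R : Subalgebra k K, R.FG → R.toSubring ≤ O.toSubring →
      ∃ (T : Type) (_ : CommRing T) (_ : Algebra k T), Algebra.Smooth k T ∧
        ∃ (ψ : R →ₐ[k] T) (χ : T →ₐ[k] K), (∀ t : T, χ t ∈ O) ∧ ∀ r : R, χ (ψ r) = (r : K)

/-- The crux is, DEFINITIONALLY, `SmoothingAt` over all perfect `k` of prime characteristic. -/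
theorem valuativeSmoothing_iff :
    ValuativeSmoothing ↔ ∀ p : ℕ, p.Prime → ∀ (k K : Type) [Field k] [CharP k p] [PerfectField k]
      [Field K] [Algebra k K], SmoothingAt k K :=
  Iff.rfl

/-! ## §1 Sanity: redundancy of `hO`, necessity of `hRO`, the degenerate instance, consistency -/

/-- The hypothesis `hO : ∀ c, algebraMap k K c ∈ O` of the crux is REDUNDANT: it follows from
`R.toSubring ≤ O.toSubring` because a `k`-subalgebra contains `k`. (Information for provers; not a
defect.) -/
theorem algebraMap_mem_of_le {k K : Type} [Field k] [Field K] [Algebra k K] (O : ValuationSubring K)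
    (R : Subalgebra k K) (hRO : R.toSubring ≤ O.toSubring) (c : k) : algebraMap k K c ∈ O :=
  hRO (R.algebraMap_mem c)

/-- The conclusion of the crux FORCES `R ≤ O` (`r = χ (ψ r) ∈ χ(T) ⊆ O`): the hypothesis `hRO`
cannot be weakened. -/
theorem le_of_smoothFactor {k K : Type} [Field k] [Field K] [Algebra k K] (O : ValuationSubring K)
    (R : Subalgebra k K) {T : Type} [CommRing T] [Algebra k T] (ψ : R →ₐ[k] T) (χ : T →ₐ[k] K)
    (hχ : ∀ t : T, χ t ∈ O) (hψχ : ∀ r : R, χ (ψ r) = (r : K)) : R.toSubring ≤ O.toSubring := by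
  intro x hx
  have := hχ (ψ ⟨x, hx⟩)
  rwa [hψχ] at this

/-- The degenerate instance `K = k` of the crux holds, with `T = k`. -/
theorem smoothingAt_self (k : Type) [Field k] : SmoothingAt k k := by
  intro _ O hO R _ _
  exact ⟨k, inferInstance, inferInstance, inferInstance, R.val, AlgHom.id k k, fun t => hO t,
    fun r => rfl⟩

/-- The hypotheses of the crux are simultaneously satisfiable (`p = 2`, `k = K = 𝔽₂`, `O = K`,
`R = k`): the crux is not vacuous. -/
theorem hypotheses_satisfiable :
    ∃ (p : ℕ) (_ : p.Prime) (k K : Type) (_ : Field k) (_ : CharP k p) (_ : PerfectField k)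
      (_ : Field K) (_ : Algebra k K), (⊤ : IntermediateField k K).FG ∧
        ∃ O : ValuationSubring K, (∀ c : k, algebraMap k K c ∈ O) ∧
          ∃ R : Subalgebra k K, R.FG ∧ R.toSubring ≤ O.toSubring :=
  ⟨2, Nat.prime_two, ZMod 2, ZMod 2, inferInstance, inferInstance, inferInstance, inferInstance,
    inferInstance, IntermediateField.fg_of_noetherian ⊤, ⊤, fun _ => ValuationSubring.mem_top _, ⊥,
    Subalgebra.fg_bot, fun x _ => ValuationSubring.mem_top x⟩

/-! ## §2 `PerfectField k` is load-bearing

### §2.1 The mechanism: formally smooth algebras contain no inseparable elements over `k` -/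

section Mechanism

variable {S k : Type*} [CommRing S] [Field k] [Algebra S k] (D : Derivation S k k)
  (T : Type*) [CommRing T] [Algebra k T]

/-- The structure map `c ↦ (c, D c) : k → T[ε] = TrivSqZeroExt T T` twisted by the derivation
`D`; a ring homomorphism because `D` is a derivation. [folklore] -/
def twistHom : k →+* TrivSqZeroExt T T where
  toFun c := (algebraMap k T c, algebraMap k T (D c))
  map_one' := by
    refine TrivSqZeroExt.ext ?_ ?_
    · simp
    · simp [Derivation.map_one_eq_zero]
  map_mul' a b := by
    refine TrivSqZeroExt.ext ?_ ?_
    · simp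
    · change algebraMap k T (D (a * b)) =
        algebraMap k T a • algebraMap k T (D b) + MulOpposite.op (algebraMap k T b) • algebraMap k T (D a)
      rw [D.leibniz]
      simp only [MulOpposite.smul_eq_mul_unop, MulOpposite.unop_op, smul_eq_mul, map_add, map_mul]
      ring
  map_zero' := by
    refine TrivSqZeroExt.ext ?_ ?_ <;> simp
  map_add' a b := by
    refine TrivSqZeroExt.ext ?_ ?_ <;> simp

@[simp] theorem fst_twistHom (c : k) : (twistHom D T c).fst = algebraMap k T c := rfl

@[simp] theorem snd_twistHom (c : k) : (twistHom D T c).snd = algebraMap k T (D c) := rfl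

/-- `T[ε]` as a TYPE SYNONYM carrying the `k`-algebra structure twisted by `D` (the untwisted
Mathlib instance on `TrivSqZeroExt T T` must not interfere). [folklore] -/
@[nolint unusedArguments]
def Twist (_D : Derivation S k k) (T : Type*) [CommRing T] [Algebra k T] : Type _ :=
  TrivSqZeroExt T T

instance : CommRing (Twist D T) := inferInstanceAs (CommRing (TrivSqZeroExt T T))

instance : Algebra k (Twist D T) := (twistHom D T : k →+* TrivSqZeroExt T T).toAlgebra

/-- First projection `T[ε] → T`, a `k`-algebra map for the twisted structure. [folklore] -/
def proj : Twist D T →ₐ[k] T where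
  toFun x := (x : TrivSqZeroExt T T).fst
  map_one' := TrivSqZeroExt.fst_one
  map_mul' x y := TrivSqZeroExt.fst_mul x y
  map_zero' := TrivSqZeroExt.fst_zero
  map_add' x y := TrivSqZeroExt.fst_add x y
  commutes' _ := rfl

theorem proj_surjective : Function.Surjective (proj D T) :=
  fun t => ⟨(TrivSqZeroExt.inl t : TrivSqZeroExt T T), rfl⟩

/-- The kernel `εT` of the projection is square-zero. [folklore] -/
theorem ker_proj_sq : RingHom.ker (proj D T : Twist D T →+* T) ^ 2 = ⊥ := by
  rw [pow_two, eq_bot_iff, Ideal.mul_le]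
  intro x hx y hy
  rw [RingHom.mem_ker] at hx hy
  rw [Ideal.mem_bot]
  revert x y
  change ∀ x : TrivSqZeroExt T T, x.fst = 0 → ∀ y : TrivSqZeroExt T T, y.fst = 0 → x * y = 0
  intro x hx y hy
  refine TrivSqZeroExt.ext ?_ ?_
  · rw [TrivSqZeroExt.fst_mul, hx, zero_mul, TrivSqZeroExt.fst_zero]
  · rw [TrivSqZeroExt.snd_mul, hx, hy, zero_smul, MulOpposite.op_zero, zero_smul, add_zero,
      TrivSqZeroExt.snd_zero]

theorem isNilpotent_ker_proj : IsNilpotent (RingHom.ker (proj D T : Twist D T →+* T)) :=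
  ⟨2, by rw [ker_proj_sq]; rfl⟩

variable [Algebra.FormallySmooth k T]

/-- The formally-smooth lift of `id : T → T` through `T[ε] ↠ T`, as a ring map into the dual
numbers: `x ↦ x + D'(x) ε` with `D'` a derivation of `T` EXTENDING `D`. [folklore] -/
def liftHom : T →+* TrivSqZeroExt T T :=
  (Algebra.FormallySmooth.liftOfSurjective (AlgHom.id k T) (proj D T) (proj_surjective D T)
    (isNilpotent_ker_proj D T)).toRingHom

theorem fst_liftHom (x : T) : (liftHom D T x).fst = x :=
  Algebra.FormallySmooth.liftOfSurjective_apply (AlgHom.id k T) (proj D T) (proj_surjective D T)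
    (isNilpotent_ker_proj D T) x

/-- The lift extends the twist: `σ(c) = c + D(c) ε` for `c ∈ k`. [folklore] -/
theorem liftHom_algebraMap (c : k) : liftHom D T (algebraMap k T c) = twistHom D T c :=
  (Algebra.FormallySmooth.liftOfSurjective (AlgHom.id k T) (proj D T) (proj_surjective D T)
    (isNilpotent_ker_proj D T)).commutes c

end Mechanism

/-- **No formally smooth `k`-algebra contains a `p`-th root of an element of `k` moved by a
derivation.** If `D` is a derivation of the field `k` of characteristic `p`, `a ∈ k` has
`D a ≠ 0`, and `T ≠ 0` is formally smooth over `k`, then no `b ∈ T` satisfies `b ^ p = a`.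
Proof: the lift `σ : T → T[ε]` of §2.1 is a ring map with `σ(a) = a + D(a)ε` and
`σ(a) = σ(b^p) = σ(b)^p = b^p + p·b^{p-1}D'(b)ε = b^p`, so `D(a) = 0` in `T ⊇ k`. (Equivalently:
`T ⊗ₖ k(a^{1/p})` would be non-reduced; or `da ≠ 0` in `Ω_k` injects into `Ω_T` by the split
first fundamental sequence.) [folklore] -/
theorem false_of_pow_char_eq_algebraMap {S k : Type*} [CommRing S] [Field k] [Algebra S k]
    (D : Derivation S k k) (p : ℕ) [CharP k p] {T : Type*} [CommRing T] [Algebra k T]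
    [Algebra.FormallySmooth k T] [Nontrivial T] (a : k) (ha : D a ≠ 0) (b : T)
    (hb : b ^ p = algebraMap k T a) : False := by
  haveI : CharP T p := charP_of_injective_algebraMap (algebraMap k T).injective p
  have h1 : (liftHom D T (algebraMap k T a)).snd = algebraMap k T (D a) := by
    rw [liftHom_algebraMap]; rfl
  have h2 : (liftHom D T (algebraMap k T a)).snd = 0 := by
    rw [← hb, map_pow, TrivSqZeroExt.snd_pow_of_smul_comm _ _ (by
      rw [MulOpposite.smul_eq_mul_unop, MulOpposite.unop_op, smul_eq_mul, mul_comm]), nsmul_eq_mul,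
      CharP.cast_eq_zero, zero_mul]
  exact ha ((algebraMap k T).injective (by rw [map_zero, ← h2, h1]))

/-! ### §2.2 The witness: `k = 𝔽_p(x) ⊂ K = k(x^{1/p})`, trivial valuation -/

section Witness

variable (p : ℕ) [Fact p.Prime]

/-- `d/dx` on `𝔽_p(x)` (extension of `Polynomial.derivative` to the fraction field, via the tree's
`Derivation.fractionFieldExtend`). -/
def ddx : Derivation (ZMod p) (RatFunc (ZMod p)) (RatFunc (ZMod p)) :=
  (mkDerivation (ZMod p) (1 : RatFunc (ZMod p))).fractionFieldExtend (F := RatFunc (ZMod p))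

theorem ddx_X : ddx p RatFunc.X = 1 := by
  rw [ddx, ← RatFunc.algebraMap_X, Derivation.fractionFieldExtend_algebraMap, mkDerivation_X]

/-- `x ∈ 𝔽_p(x)` is not a `p`-th power (a derivation kills `p`-th powers, but `dx/dx = 1`). -/
theorem pow_ne_X (b : RatFunc (ZMod p)) : b ^ p ≠ RatFunc.X := by
  intro h
  have h1 : ddx p (b ^ p) = 0 := by
    rw [Derivation.leibniz_pow, nsmul_eq_mul, CharP.cast_eq_zero, zero_mul]
  rw [h, ddx_X] at h1
  exact one_ne_zero h1

/-- The purely inseparable polynomial `Y^p - x ∈ 𝔽_p(x)[Y]`. -/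
def insepPoly : (RatFunc (ZMod p))[X] := X ^ p - C RatFunc.X

theorem insepPoly_irreducible : Irreducible (insepPoly p) :=
  X_pow_sub_C_irreducible_of_prime (Fact.out : p.Prime) (pow_ne_X p)

instance : Fact (Irreducible (insepPoly p)) := ⟨insepPoly_irreducible p⟩

/-- `K = 𝔽_p(x)(x^{1/p}) = 𝔽_p(x^{1/p})`, a field, finite purely inseparable of degree `p` over
`k = 𝔽_p(x)`. -/
abbrev Kp : Type := AdjoinRoot (insepPoly p)

theorem root_pow : (AdjoinRoot.root (insepPoly p)) ^ p = algebraMap (RatFunc (ZMod p)) (Kp p) RatFunc.X := by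
  have h : aeval (AdjoinRoot.root (insepPoly p)) (insepPoly p) = 0 := by
    rw [AdjoinRoot.aeval_eq, AdjoinRoot.mk_self]
  change aeval (AdjoinRoot.root (insepPoly p)) (X ^ p - C RatFunc.X) = 0 at h
  rw [map_sub, map_pow, aeval_X, aeval_C, sub_eq_zero] at h
  exact h

theorem fg_top_Kp : (⊤ : IntermediateField (RatFunc (ZMod p)) (Kp p)).FG := by
  have h : IntermediateField.adjoin (RatFunc (ZMod p)) {AdjoinRoot.root (insepPoly p)} = ⊤ := by
    rw [eq_top_iff]
    intro x _
    exact IntermediateField.algebra_adjoin_le_adjoin _ _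
      (by rw [AdjoinRoot.adjoinRoot_eq_top]; exact Algebra.mem_top)
  rw [← h]
  exact IntermediateField.fg_adjoin_of_finite (Set.finite_singleton _)

/-- **The crux fails over the imperfect field `𝔽_p(x)`**, for the trivial valuation ring `O = K`
of `K = 𝔽_p(x^{1/p})` and `R = K = k[x^{1/p}]`: no smooth `k`-algebra receives `x^{1/p}`
compatibly with a map to `K`. -/
theorem not_smoothingAt_insep : ¬ SmoothingAt (RatFunc (ZMod p)) (Kp p) := by
  intro h
  have hRfg : (⊤ : Subalgebra (RatFunc (ZMod p)) (Kp p)).FG :=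
    ⟨{AdjoinRoot.root (insepPoly p)}, by rw [Finset.coe_singleton]; exact AdjoinRoot.adjoinRoot_eq_top⟩
  obtain ⟨T, _, _, hT, ψ, χ, -, hψχ⟩ := h (fg_top_Kp p) ⊤ (fun _ => ValuationSubring.mem_top _) ⊤ hRfg
    (fun x _ => ValuationSubring.mem_top x)
  haveI : Algebra.Smooth (RatFunc (ZMod p)) T := hT
  haveI : Nontrivial T := χ.toRingHom.domain_nontrivial
  set r : (⊤ : Subalgebra (RatFunc (ZMod p)) (Kp p)) := ⟨AdjoinRoot.root (insepPoly p), Algebra.mem_top⟩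
  have hr : r ^ p = algebraMap (RatFunc (ZMod p)) _ RatFunc.X := Subtype.ext (by
    rw [SubmonoidClass.coe_pow, Subalgebra.coe_algebraMap]; exact root_pow p)
  have hb : (ψ r) ^ p = algebraMap (RatFunc (ZMod p)) T RatFunc.X := by
    rw [← map_pow, hr, AlgHom.commutes]
  exact false_of_pow_char_eq_algebraMap (ddx p) p RatFunc.X (by rw [ddx_X]; exact one_ne_zero) (ψ r) hb

end Witness

/-- The crux with the hypothesis `[PerfectField k]` DROPPED (everything else verbatim). -/
def ValuativeSmoothingWithoutPerfectField : Prop :=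
  ∀ p : ℕ, p.Prime → ∀ (k K : Type) [Field k] [CharP k p] [Field K] [Algebra k K], SmoothingAt k K

/-- It fails at EVERY prime `p` (witness `𝔽_p(x) ⊂ 𝔽_p(x^{1/p})`, trivial valuation). -/
theorem valuativeSmoothingWithoutPerfectField_fails_at (p : ℕ) (hp : p.Prime) :
    ¬ ∀ (k K : Type) [Field k] [CharP k p] [Field K] [Algebra k K], SmoothingAt k K := by
  haveI : Fact p.Prime := ⟨hp⟩
  intro h
  exact not_smoothingAt_insep p (h (RatFunc (ZMod p)) (Kp p))

/-- **`PerfectField k` is load-bearing**: any proof of the crux must use perfectness of `k`.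
[folklore] -/
theorem valuativeSmoothing_false_without_perfectField : ¬ ValuativeSmoothingWithoutPerfectField :=
  fun h => valuativeSmoothingWithoutPerfectField_fails_at 2 Nat.prime_two (h 2 Nat.prime_two)

/-! ## §3 `R.FG` is load-bearing: `O` itself is not a retract of a smooth algebra -/

/-- The crux with the hypothesis `R.FG` DROPPED (everything else verbatim). -/
def ValuativeSmoothingWithoutFG : Prop :=
  ∀ p : ℕ, p.Prime → ∀ (k K : Type) [Field k] [CharP k p] [PerfectField k] [Field K] [Algebra k K],
    (⊤ : IntermediateField k K).FG → ∀ O : ValuationSubring K, (∀ c : k, algebraMap k K c ∈ O) →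
      ∀ R : Subalgebra k K, R.toSubring ≤ O.toSubring →
        ∃ (T : Type) (_ : CommRing T) (_ : Algebra k T), Algebra.Smooth k T ∧
          ∃ (ψ : R →ₐ[k] T) (χ : T →ₐ[k] K), (∀ t : T, χ t ∈ O) ∧ ∀ r : R, χ (ψ r) = (r : K)

/-- `𝔽_q(x)` is finitely generated as a field over `𝔽_q` (essentially of finite type). -/
theorem fg_top_ratFunc (k : Type) [Field k] : (⊤ : IntermediateField k (RatFunc k)).FG := by
  rw [IntermediateField.fg_top_iff]
  haveI : Algebra.EssFiniteType k[X] (RatFunc k) :=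
    Algebra.EssFiniteType.of_isLocalization (RatFunc k) (nonZeroDivisors k[X])
  exact Algebra.EssFiniteType.comp k k[X] (RatFunc k)

/-- A field receiving a SURJECTION from a `k`-algebra of finite type is algebraic over `k`
(Zariski's lemma), so it cannot contain a transcendental: `𝔽_q(x)` is not a quotient of a
finite-type `k`-algebra. [folklore] -/
theorem not_surjective_of_finiteType (k : Type) [Field k] {T : Type} [CommRing T] [Algebra k T]
    [Algebra.FiniteType k T] (χ : T →ₐ[k] RatFunc k) : ¬ Function.Surjective χ := by
  intro hχ
  obtain ⟨n, f, hf⟩ := Algebra.FiniteType.iff_quotient_mvPolynomial''.1 (‹Algebra.FiniteType k T›)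
  have hsurj : Function.Surjective ((χ.comp f : MvPolynomial (Fin n) k →+* RatFunc k)) :=
    hχ.comp hf
  have hint := MvPolynomial.comp_C_integral_of_surjective_of_isJacobsonRing _ hsurj
  have heq : ((χ.comp f : MvPolynomial (Fin n) k →+* RatFunc k)).comp MvPolynomial.C =
      algebraMap k (RatFunc k) := by
    rw [← MvPolynomial.algebraMap_eq]
    exact (χ.comp f).comp_algebraMap
  rw [heq] at hint
  have hX : IsIntegral k (RatFunc.X : RatFunc k) := hint RatFunc.X
  have htr : Transcendental k (RatFunc.X : RatFunc k) := by
    rw [← RatFunc.algebraMap_X, transcendental_algebraMap_iff (IsFractionRing.injective k[X] (RatFunc k))]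
    exact transcendental_X k
  exact htr hX.isAlgebraic

/-- **`R.FG` is load-bearing**: with `R = O = K = 𝔽₂(x)` (trivial valuation) a factorisation
`K → T → K` of the identity makes `K` a quotient of the finite-type algebra `T`, contradicting
Zariski's lemma. So `O` is "ind"-smooth at best, never a retract of one smooth algebra (unless
`K/k` is algebraic). [folklore] -/
theorem valuativeSmoothing_false_without_fg : ¬ ValuativeSmoothingWithoutFG := by
  intro h
  obtain ⟨T, _, _, hT, ψ, χ, -, hψχ⟩ := h 2 Nat.prime_two (ZMod 2) (RatFunc (ZMod 2))
    (fg_top_ratFunc (ZMod 2)) ⊤ (fun _ => ValuationSubring.mem_top _) ⊤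
    (fun x _ => ValuationSubring.mem_top x)
  haveI : Algebra.Smooth (ZMod 2) T := hT
  refine not_surjective_of_finiteType (ZMod 2) χ fun x => ?_
  exact ⟨ψ ⟨x, Algebra.mem_top⟩, hψχ ⟨x, Algebra.mem_top⟩⟩

/-! ## §4 Consequences recorded for the provers (prose in the module docstring):
the crux is implied by `LurelPerfect` (support item `UniformizingToSmooth`), a refutation refutes
LU in characteristic `p`; the smallest open instances are defect valuations of `k(x,y,z,w)`,
`k` perfect. -/

end Summit.ResolutionOfSingularities.ResolutionOfSingularities.Cruxes.ValuativeSmoothing.Disproof
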